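import Literature.AnabelianGeometry.EtaleTheta.MuTwoSettingCLevel
import Literature.AnabelianGeometry.EtaleTheta.DoubleUnderlineTower
import Literature.AnabelianGeometry.SemiGraphs.TemperedCompletionExtension
import Literature.AnabelianGeometry.SemiGraphs.TemperedCurveGaloisInfinite

/-!
# B14 «PlusMinusTower.ofCoverModel», CORE over an abstract completion `Π^tp_C ↪ Π̂_C` (proof-only), PART 1: the augmentation
# `Π̂_C ↠ G_K`

S. Mochizuki, *Inter-universal Teichmüller theory II*, kurims manuscript (Dec. 2020), §2, Def. 2.3 (i) p. 67 ([IUTchII] Def 2.3 (i),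
kurims p.67) [claim: Mochizuki2012, status: disputed] (D-0012 claim key; series status DISPUTED — classical profinite group theory over
abc-iut-L2's [EtTh] data only; nothing of the series is asserted); [SemiAnbd] §6 p. 69 [cite: MochizukiSemiAnbd2006, §6 p.69].
PROOF-ONLY file (abc-iut cell, seat abc-iut-L6-t19 gen 5, HOLDER-DESIGNATE of MERGE-MAP row B14; design note
HOME/staging/L6/L6-t19/B14-DESIGN.md); no definitions — everything is an `∃`/`∀` statement over an ARBITRARY profinite completion
`ι : Π^tp_C → Q` (`IsProfiniteCompletion ι`; such a `Q` with `ι` injective EXISTS by `exists_injective_completion_of_isOpenEmbedding`,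
p423691), so that the def-bearing assembly `PlusMinusTower.ofCoverModel` only has to CHOOSE `Q` and package these facts.

* `MuTwoSetting.CLevelData.exists_augC_codRestrict` — `augC` corestricted to the subgroup `G_K ≤ G_{ℚ_p}` (continuous);
* **`MuTwoSetting.CLevelData.exists_augHat`** — THE FIELD `aug` (with `aug_surjective`) of the tower: for ANY profinite completion
  `ι : Π^tp_C → Q`, `augC` extends along `ι` to a continuous `Φ : Q → G_K` (`G_K` profinite: abc-iut-L3 `TemperedCurve.compactSpace_GK`;
  abc-iut-L3 `IsProfiniteCompletion.exists_extension`), SURJECTIVE because already `Π^tp_X ↠ G_K` (`range_aug`).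

PART 2 (separate file, once abc-iut-L2's `Sec2CompletionIndex`/`Sec2CompletionNormal` and the Prelims p423833 are built on the farm):
`[Q : cl ι(Π^tp_X̲)] = 2l`, `[cl ι(Π^tp_X̲) : cl ι(Π^tp_X̲̲)] = l`, `cl ι(Π^tp_X̲) ⊴ Q` (mod L02), `cl ι(Π^tp_X̲̲) ⊴ cl ι(Π^tp_X̲)` (mod hN).
Nothing here takes a side on [IUTchIII] Cor. 3.12; typed ≠ proved.
-/

noncomputable section

namespace Literature.AnabelianGeometry.EtaleTheta

open Literature.AnabelianGeometry.SemiGraphs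

namespace MuTwoSetting

namespace CLevelData

variable {p : ℕ} [Fact p.Prime] {M : MuTwoSetting p} (e : M.CLevelData)
  {Q : Type} [Group Q] [TopologicalSpace Q] [IsTopologicalGroup Q] (ι : M.GtpC →ₜ* Q) (hι : IsProfiniteCompletion ι)

/-- The augmentation `Π^tp_C → G_K`, corestricted to the subgroup `G_K ≤ G_{ℚ_p}`, as a continuous homomorphism.
(Proof-internal construction exposed as an existence statement below; no `def`.) [cite: MochizukiEtTh2009, Def 1.7 p.27] -/
theorem exists_augC_codRestrict :
    ∃ ψ : M.GtpC →ₜ* ↥M.GK, ∀ g : M.GtpC, ((ψ g : M.GK) : GQp p) = e.augC g :=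
  ⟨{ toMonoidHom := e.augC.toMonoidHom.codRestrict M.GK e.augC_mem_GK
     continuous_toFun := e.augC.continuous.subtype_mk _ }, fun _ => rfl⟩

include hι in
/-- **The augmentation of `Π̂_C`**: for any profinite completion `ι : Π^tp_C → Q`, the augmentation `augC : Π^tp_C → G_K` extends
along `ι` to a continuous homomorphism `Φ : Q → G_K` (`G_K` is profinite: abc-iut-L3's `TemperedCurve.compactSpace_GK`; abc-iut-L3's
`IsProfiniteCompletion.exists_extension`), and `Φ` is SURJECTIVE because already `Π^tp_X ↠ G_K` (`range_aug`).  PROVED.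
([IUTchII] Def 2.3 (i), kurims p.67) [claim: Mochizuki2012, status: disputed] -/
theorem exists_augHat :
    ∃ Φ : Q →ₜ* ↥M.GK, (∀ g : M.GtpC, ((Φ (ι g) : M.GK) : GQp p) = e.augC g) ∧ Function.Surjective Φ := by
  haveI : CompactSpace ↥M.GK := M.toTemperedCurve.compactSpace_GK
  obtain ⟨ψ, hψ⟩ := e.exists_augC_codRestrict
  obtain ⟨Φ, hΦ⟩ := hι.exists_extension ψ
  refine ⟨Φ, fun g => by rw [hΦ g, hψ g], ?_⟩
  intro k
  -- `k ∈ G_K = aug(Π^tp_X)`; lift to `Π^tp_X ⊆ Π^tp_C`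
  have hk : (k : GQp p) ∈ M.aug.toMonoidHom.range := by rw [M.range_aug]; exact k.2
  obtain ⟨x, hx⟩ := hk
  refine ⟨ι (M.inclX x), Subtype.ext ?_⟩
  rw [hΦ, hψ, e.augC_inclX]
  exact hx

end CLevelData

end MuTwoSetting

end Literature.AnabelianGeometry.EtaleTheta

end
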